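import Mathlib
import Summits.NavierStokesRegularity.NavierStokesRegularity.Theorems.TaoLadderRungTwoFlatBehindAprioriSharp
import HarnessLib

/-!
# NEAR FEED 57 — D12: the behind zone's interface amplitude `A₁` FED from the near zone's in-hop deviation energy, and the
  behind hop with `A₁`, `A₀` substituted (helper for the K_A♭ parent item stmt-NavierStokesRegularity-22987
  `FlatGapCertificatesV2`, child 2A `GradedAdiabaticWakeA` of route TaoLadderRungTwoFlat; cell harvest/h2-tao-ladder,
  theory-1 g45, memo numT57/NEAR-BEHIND-57 / LADDER §57)

PROVENANCE (p1 g23): theory-1 g45's image of record numT57/NearFeed57.lean sha16 6d3e104193a98415 (farm `lean check` rc 0 ·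
0 sorry · 0 warnings · std axioms), landed with declarations BYTE-IDENTICAL (companion of p1's `…NearBehindApriori`, which
closes the joint near/behind loop by continuous induction; this file is the substitution form without the loop). The image's
module docstring follows verbatim.

# Cell Lean (theory-1 g45, numT57): D12 — the behind hop's interface amplitudes FED from the near zone's in-hop energy level
  and the template (typed cross-zone input; helper shapes for the K_A♭ parent item stmt-NavierStokesRegularity-22987
  `FlatGapCertificatesV2`, child 2A `GradedAdiabaticWakeA` of route TaoLadderRungTwoFlat; cell harvest/h2-tao-ladder)

p1 g23's `R54.behindEnergyClause_hop_of_schedule_sharp` (tree, `…BehindAprioriSharp`, referee c88 A-98 applied) closes the behind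
hop modulo the interface amplitudes `hA₁ : |S 1 (−K) t| ≤ A₁` (a shell inside the landing block; referee W-25: a CROSS-ZONE input)
and `hA₀ : |S 0 (1−K) t| ≤ A₀` (the core's bottom carrier). Feeding `A₁` from the behind clause itself (`A₁ = √(2V̄)e^{θ′/2}`) is
infeasible at every `ε₀` (cell memo NEAR-BEHIND-57 §2, desk floats UNSEALED); the near zone's in-hop DEVIATION energy on `[1−D, −K]`
has weight `e^{−θ_V σt} ≥ e^{−θ_V}` at its top shell `−K`, so it bounds the deviation there by `√(2b₁)e^{θ_V/2}`, and the template
supplies the rest. This file types that feed and substitutes it: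

* `abs_top_le_of_nearEnergy_le` — `|S 1 (−K) t| ≤ M₁ + √(2b₁)·e^{θ_V/2}` from the near in-hop energy level `b₁` and `|W 1 (−K) t| ≤ M₁`;
* `abs_le_of_abs_sub_le` — template + deviation (for the core's bottom carrier: `A₀ := M₀ + r̄`);
* `behindEnergyClause_hop_of_schedule_fed` — p1's sharp behind hop with `A₁ := M₁ + √(2b₁)e^{θ_V/2}`, `A₀ := M₀ + r̄` SUBSTITUTED:
  the behind hop's cross-zone consumption is NAMED — `b₁` (near, in-hop energy level), `r̄` (core, in-hop bottom deviation),
  `M₁`, `M₀` (template statics) — and nothing is assumed about the behind zone's own top shell.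

HONEST FRAMING: inequalities about MODEL-lattice certificate flows (graded mirror table on `S♭`, `m = 2`); the near/core in-hop
levels and the scalar schedule inequalities are HYPOTHESES; nothing certified; no item closed; nothing about the Navier–Stokes
equations. Cell file (theory desk); p1 may land it or re-cut it.
-/

noncomputable section

-- the sub-problem namespace repeats the summit name by design (D-0017)
set_option linter.dupNamespace false

namespace Summit.NavierStokesRegularity.NavierStokesRegularity.Theorems.HopTube.R54

open Set Finset Literature.Analysis.FluidPDE Literature.Analysis.FluidPDE.TaoCascade MirrorPulse

/-- **Top interface amplitude from the near zone's in-hop deviation energy (D12).** If the near zone's co-moving deviation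
energy on `[1−D, −K]` (edge `−K + σt`, `σt ≤ 1`) is `≤ b₁` at time `t` and the template satisfies `|W 1 (−K) t| ≤ M₁`, then
`|S 1 (−K) t| ≤ M₁ + √(2b₁)·e^{θ_V/2}`. [cite: Tao2016AveragedNS, §4 (4.3) (energy ⇒ amplitude); route TaoLadderRungTwoFlat, D12 / L-57b (cell LADDER §57)] -/
theorem abs_top_le_of_nearEnergy_le {θV σ b₁ M₁ : ℝ} {D K : ℕ} {S W : Fin 2 → ℤ → ℝ → ℝ} {t : ℝ}
    (hθ : 0 ≤ θV) (hσt1 : σ * t ≤ 1) (hDK : K + 1 ≤ D)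
    (hV : coMovingEnergyOn (Finset.Icc (1 - (D : ℤ)) (-(K : ℤ))) θV (-(K : ℝ) + σ * t) (S - W) t ≤ b₁)
    (hM : |W 1 (-(K : ℤ)) t| ≤ M₁) :
    |S 1 (-(K : ℤ)) t| ≤ M₁ + Real.sqrt (2 * b₁) * Real.exp (θV / 2) := by
  have hmem : (-(K : ℤ)) ∈ Finset.Icc (1 - (D : ℤ)) (-(K : ℤ)) := by
    have : ((K + 1 : ℕ) : ℤ) ≤ (D : ℤ) := by exact_mod_cast hDK
    push_cast at this
    exact Finset.mem_Icc.mpr ⟨by omega, le_rfl⟩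
  have h1 := abs_le_of_blockEnergy_le hV 1 hmem
  have hK : (((-(K : ℤ)) : ℤ) : ℝ) = -(K : ℝ) := by push_cast; ring
  rw [hK] at h1
  have hexp : Real.exp (θV * ((-(K : ℝ) + σ * t) - (-(K : ℝ))) / 2) ≤ Real.exp (θV / 2) := by
    rw [Real.exp_le_exp]
    have : θV * ((-(K : ℝ) + σ * t) - (-(K : ℝ))) = θV * (σ * t) := by ring
    rw [this]
    nlinarith [mul_le_mul_of_nonneg_left hσt1 hθ]
  have hs0 : 0 ≤ Real.sqrt (2 * b₁) := Real.sqrt_nonneg _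
  have hdev : |(S - W) 1 (-(K : ℤ)) t| ≤ Real.sqrt (2 * b₁) * Real.exp (θV / 2) :=
    h1.trans (mul_le_mul_of_nonneg_left hexp hs0)
  have hsub : (S - W) 1 (-(K : ℤ)) t = S 1 (-(K : ℤ)) t - W 1 (-(K : ℤ)) t := by simp [Pi.sub_apply]
  rw [hsub] at hdev
  have htri : |S 1 (-(K : ℤ)) t| - |W 1 (-(K : ℤ)) t| ≤ |S 1 (-(K : ℤ)) t - W 1 (-(K : ℤ)) t| :=
    abs_sub_abs_le_abs_sub _ _
  linarith

/-- **Amplitude from template + deviation** (the core's bottom carrier `a_{1−K}` during the hop: template bound `M₀` plus the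
core's in-hop bottom deviation `r̄`). [folklore (triangle inequality); route TaoLadderRungTwoFlat, D12 (cell LADDER §57)] -/
theorem abs_le_of_abs_sub_le {S W : Fin 2 → ℤ → ℝ → ℝ} {i : Fin 2} {k : ℤ} {t M r : ℝ}
    (hM : |W i k t| ≤ M) (hr : |(S - W) i k t| ≤ r) : |S i k t| ≤ M + r := by
  have hsub : (S - W) i k t = S i k t - W i k t := by simp [Pi.sub_apply]
  rw [hsub] at hr
  have htri : |S i k t| - |W i k t| ≤ |S i k t - W i k t| := abs_sub_abs_le_abs_sub _ _
  linarith

section Fed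

variable {ε ε₀ τ κ₂ : ℝ} {S₀ F₀ B₀ : Fin 2 → ℤ → ℝ} {S F : Fin 2 → ℤ → ℝ → ℝ}

/-- **THE BEHIND HOP WITH THE CROSS-ZONE FEED TYPED (D12 on p1's sharp closing level).** The interface amplitudes of
`behindEnergyClause_hop_of_schedule_sharp` are SUBSTITUTED: `A₁ := M₁ + √(2b₁)e^{θ_V/2}` from the near zone's in-hop deviation
energy level `b₁` on `[1−D, −K]` and the template bound `M₁` at `(1, −K)`; `A₀ := M₀ + r̄` from the template bound `M₀` at
`(0, 1−K)` and the core's in-hop bottom deviation `r̄`. [cite: Tao2016AveragedNS, §4 (4.1), (4.3), (4.5), (4.8), §6.3–6.4 (statement shape); route TaoLadderRungTwoFlat, `HopTube.TubeStepBehind` under R54-1, D12 / L-57b (cell LADDER §57)] -/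
theorem behindEnergyClause_hop_of_schedule_fed
    (hS : PseudoFlowOnShift shiftSetFlat τ ε₀ (mirrorTable ε ε) 0 κ₂ S₀ F₀ B₀ S F)
    (hε : 0 ≤ ε) (hε₀ : 0 < ε₀) {K D : ℕ} {θ' θV σ τ₁ a Aeff b₁ M₁ M₀ rbar μ Wn aK rk Vbar W' : ℝ}
    {z : Fin 2 → ℤ → ℝ} {W : Fin 2 → ℤ → ℝ → ℝ}
    (hθ : 0 < θ') (hθ5 : θ' ≤ 5 * Real.log (1 + ε₀)) (hθV : 0 ≤ θV) (hDK : K + 1 ≤ D) (hAeff : 0 < Aeff)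
    (hτ₁ : 0 < τ₁) (hτ₁τ : τ₁ ≤ τ) (hστ : σ * τ₁ = 1) (ha : 0 < a)
    (hWc : BehindEnergyClause K θ' Wn z) (hWn : 0 ≤ Wn) (haK : ∀ i, |z i (-(K : ℤ))| ≤ aK)
    (hkick : ∀ (i : Fin 2) (k : ℤ), k ≤ -(K : ℤ) → |S₀ i k - z i k| ≤ rk) (hrk : 0 ≤ rk)
    -- the cross-zone feed (D12): near in-hop energy level, template bounds, core in-hop bottom deviation
    (hb₁ : ∀ t ∈ Ioo 0 τ₁,
      coMovingEnergyOn (Finset.Icc (1 - (D : ℤ)) (-(K : ℤ))) θV (-(K : ℝ) + σ * t) (S - W) t ≤ b₁)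
    (hM₁ : ∀ t ∈ Ioo 0 τ₁, |W 1 (-(K : ℤ)) t| ≤ M₁)
    (hM₀ : ∀ t ∈ Icc 0 τ₁, |W 0 (-(K : ℤ) + 1) t| ≤ M₀)
    (hr : ∀ t ∈ Icc 0 τ₁, |(S - W) 0 (-(K : ℤ) + 1) t| ≤ rbar)
    -- the rate and the three scalar inequalities, with the fed amplitudes substituted
    (hA₀le : M₀ + rbar ≤ Aeff) (hμ : 0 < μ) (hμle : μ ≤ σ * θ' - 2 * (1 + ε) * Aeff * Real.sinh (θ' / 2))
    (hlevel : (Real.sqrt (Wn + aK ^ 2) + rk / Real.sqrt (1 - Real.exp (-θ'))) ^ 2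
        + (M₁ + Real.sqrt (2 * b₁) * Real.exp (θV / 2)) * (M₀ + rbar)
          * ((M₁ + Real.sqrt (2 * b₁) * Real.exp (θV / 2)) + ε * (M₀ + rbar)) * τ₁ < Vbar)
    (hclose : Real.sqrt (2 * Vbar) * Real.exp (θ' / 2) ≤ Aeff)
    (hbudget : Real.exp (-μ * τ₁) * (Real.sqrt (Wn + aK ^ 2) + rk / Real.sqrt (1 - Real.exp (-θ'))) ^ 2
        + (M₁ + Real.sqrt (2 * b₁) * Real.exp (θV / 2)) * (M₀ + rbar)
          * ((M₁ + Real.sqrt (2 * b₁) * Real.exp (θV / 2)) + ε * (M₀ + rbar)) * (1 - Real.exp (-μ * τ₁)) / μ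
          ≤ a ^ 2 * W') :
    BehindEnergyClause K θ' W' (recentre S τ₁ a) := by
  have hσ : 0 < σ := pos_of_mul_pos_left (by rw [hστ]; exact one_pos) hτ₁.le
  have hA₁ : ∀ t ∈ Ioo 0 τ₁, |S 1 (-(K : ℤ)) t| ≤ M₁ + Real.sqrt (2 * b₁) * Real.exp (θV / 2) := by
    intro t ht
    have hσt1 : σ * t ≤ 1 := by nlinarith [ht.2.le, hσ.le]
    exact abs_top_le_of_nearEnergy_le hθV hσt1 hDK (hb₁ t ht) (hM₁ t ht)
  have hA₀ : ∀ t ∈ Icc 0 τ₁, |S 0 (-(K : ℤ) + 1) t| ≤ M₀ + rbar := fun t ht =>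
    abs_le_of_abs_sub_le (hM₀ t ht) (hr t ht)
  exact behindEnergyClause_hop_of_schedule_sharp hS hε hε₀ hθ hθ5 hAeff hτ₁ hτ₁τ hστ ha hWc hWn haK hkick hrk hA₁ hA₀
    hA₀le hμ hμle hlevel hclose hbudget

end Fed

end Summit.NavierStokesRegularity.NavierStokesRegularity.Theorems.HopTube.R54

end
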